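import Mathlib
import Summits.ValiantsHypothesis.ValiantsHypothesis.Theorems.GrenetZeonTwoDimCoefficientsScalingPermPointHessian

/-!
# Crux `GrenetZeon.TwoDimCoefficients` (stmt-ValiantsHypothesis-8062) / rung `DualUnipotentThreeHalves` (stmt-24318):
# scaling-closure — PER-GENERICITY AT RANK-ONE POINTS (the Hessian of `per_n` at `u vᵀ` has full rank)

Second explicit family of FULL-RANK points of the Hessian of the permanent (sibling of ✓ `rank_hess0_transl_permPoint_perPoly`,
p836772): the RANK-ONE matrices `z = u vᵀ` with all `u_i, v_j ≠ 0` (the torus orbit of the all-ones matrix `J`).  Together the two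
families show on paper that EVERY HYPERPLANE of `M_n(ℂ)` contains a full-rank point of `Hess per_n` (memo NINETEENTH-HAND.md §3:
per-genericity PG(1) for the T4 programme of the 24318 decl — a row-sum hyperplane `{Σ_c a_c x_{rc} = 0}` contains no monomial
point but contains `u vᵀ` with `Σ_c a_c v_c = 0`).

* ★ `hess0_transl_rankOne_perPoly_apply` — `Hess per_n (u vᵀ)_{(c,d),(a,b)} = [a ≠ c][b ≠ d]·(n−2)!·∏_{r ∉ {a,c}} u_r·∏_{i ∉ {b,d}} v_i`
  (from the tree's `hess0_transl_perPoly` and `card_perm_apply_eq_two`);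
* ★ `offDiag2_mulVec_apply` / `offDiag2_mulVec_injective` — the pattern `M_{(c,d),(a,b)} = [a ≠ c][b ≠ d]` (`= (J−1) ⊗ (J−1)`) acts by
  inclusion–exclusion `(M y)_{(c,d)} = T − R_c − C_d + y_{(c,d)}` and is injective for `n ≠ 1`;
* ★ `hess0_transl_rankOne_perPoly_eq_smul` — `Hess per_n (u vᵀ) = (n−2)!·∏u·∏v · D M D` with `D = diag((u_a v_b)⁻¹)`;
* ★★ `rank_hess0_transl_rankOne_perPoly` — `rank Hess per_n (u vᵀ) = n²` for `n ≥ 2` and all `u_i, v_j ≠ 0`.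

HONEST FRAMING: an unconditional, route-independent computation about the permanent (no Theses import); it closes no stub:
`DualUnipotentBound`, crux 8062, the 24318 decl and `VP ≠ VNP` remain open.

References: T. Mignon, N. Ressayre, Int. Math. Res. Not. 2004:79, §3 (second partials of the permanent are sub-permanents; via the
tree); J. M. Landsberg, *Geometry and Complexity Theory* (2017), §6.4.6; folklore.
-/

-- single-conjunct layout `Summits/ValiantsHypothesis/ValiantsHypothesis`: the duplicated namespace
-- component is mandated by the tree.
set_option linter.dupNamespace false
set_option autoImplicit false

noncomputable section

namespace Summit.ValiantsHypothesis.ValiantsHypothesis.Theorems.GrenetZeonTwoDimCoefficients.ScalingClosure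

open MvPolynomial Matrix
open Literature.Computability.AlgebraicComplexity

section RankOnePoint

variable {n : ℕ}

/-- ★ **The Hessian of `per_n` at a rank-one point `u vᵀ`.**  The entry `((c,d),(a,b))` is
`(n−2)! · ∏_{r ∉ {a,c}} u_r · ∏_{i ∉ {b,d}} v_i` if `a ≠ c` and `b ≠ d`, and `0` otherwise (the `(n−2) × (n−2)` sub-permanent of a
rank-one matrix). [cite: MignonRessayre2004, §3 — via the tree; folklore] -/
theorem hess0_transl_rankOne_perPoly_apply (u v : Fin n → ℂ) (a b c d : Fin n) :
    hess0 (transl (fun p : Fin n × Fin n => u p.1 * v p.2) (perPoly (Fin n) ℂ)) (c, d) (a, b) =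
      if d ≠ b ∧ c ≠ a then ((n - 2).factorial : ℂ) *
        ((∏ r ∈ (Finset.univ.erase a).erase c, u r) * ∏ i ∈ (Finset.univ.erase b).erase d, v i) else 0 := by
  classical
  rw [hess0_transl_perPoly]
  set S := (Finset.univ.erase b).erase d with hS
  set X : ℂ := (∏ r ∈ (Finset.univ.erase a).erase c, u r) * ∏ i ∈ S, v i with hX
  -- each surviving term equals `X` (reindex the `u`-product along `π`)
  have hterm : ∀ π : Equiv.Perm (Fin n), π b = a → π d = c →
      (∏ i ∈ S, (fun p : Fin n × Fin n => u p.1 * v p.2) (π i, i)) = X := by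
    intro π hb hd
    rw [Finset.prod_mul_distrib, hX]
    congr 1
    have himg : S.map (Equiv.toEmbedding π) = (Finset.univ.erase a).erase c := by
      rw [hS, Finset.map_erase, Finset.map_erase, Finset.map_univ_equiv]
      simp [hb, hd]
    rw [← himg, Finset.prod_map]
    rfl
  by_cases hdb : d ≠ b
  · by_cases hca : c = a
    · -- no permutation has `π b = a = c = π d` with `b ≠ d`
      rw [if_neg (fun h => h.2 hca)]
      refine Finset.sum_eq_zero fun π _ => ?_
      rw [if_neg]
      rintro ⟨h1, -, h3⟩
      exact hdb (π.injective (h3.trans (hca.trans h1.symm)))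
    · rw [if_pos ⟨hdb, hca⟩]
      have h1 : ∀ π : Equiv.Perm (Fin n),
          (if π b = a ∧ d ≠ b ∧ π d = c then ∏ i ∈ S, (fun p : Fin n × Fin n => u p.1 * v p.2) (π i, i) else 0)
            = if π b = a ∧ π d = c then X else 0 := by
        intro π
        by_cases h : π b = a ∧ π d = c
        · rw [if_pos ⟨h.1, hdb, h.2⟩, if_pos h, hterm π h.1 h.2]
        · rw [if_neg (fun h' => h ⟨h'.1, h'.2.2⟩), if_neg h]
      rw [Finset.sum_congr rfl fun π _ => h1 π, Finset.sum_ite, Finset.sum_const_zero, add_zero,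
        Finset.sum_const, nsmul_eq_mul]
      congr 1
      have hcard := card_perm_apply_eq_two (α := Fin n) (Ne.symm hdb) (Ne.symm hca)
      rw [Fintype.card_subtype, Fintype.card_fin] at hcard
      exact_mod_cast hcard
  · -- `d = b`
    rw [if_neg (fun h => hdb h.1)]
    refine Finset.sum_eq_zero fun π _ => ?_
    rw [if_neg]
    rintro ⟨-, h, -⟩
    exact hdb h

/-- ★ **Inclusion–exclusion for the pattern `M_{(c,d),(a,b)} = [a ≠ c][b ≠ d]`** (`= (J − 1) ⊗ (J − 1)`):
`(M y)_{(c,d)} = Σ y − Σ_b y_{(c,b)} − Σ_a y_{(a,d)} + y_{(c,d)}`. [folklore] -/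
theorem offDiag2_mulVec_apply (y : Fin n × Fin n → ℂ) (c d : Fin n) :
    (Matrix.of fun s t : Fin n × Fin n => if s.2 ≠ t.2 ∧ s.1 ≠ t.1 then (1 : ℂ) else 0).mulVec y (c, d) =
      (∑ t, y t) - (∑ b, y (c, b)) - (∑ a, y (a, d)) + y (c, d) := by
  classical
  rw [Matrix.mulVec, dotProduct]
  simp only [Matrix.of_apply, boole_mul]
  have hsplit : ∀ t : Fin n × Fin n, (if d ≠ t.2 ∧ c ≠ t.1 then y t else 0) =
      y t - (if t.1 = c then y t else 0) - (if t.2 = d then y t else 0) + (if t = (c, d) then y t else 0) := by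
    rintro ⟨a, b⟩
    by_cases h1 : a = c
    · by_cases h2 : b = d
      · subst h1; subst h2; simp
      · have h2' : d ≠ b := fun h => h2 h.symm
        subst h1; simp [h2, h2']
    · have h1' : c ≠ a := fun h => h1 h.symm
      by_cases h2 : b = d
      · subst h2; simp [h1, h1']
      · have h2' : d ≠ b := fun h => h2 h.symm
        simp [h1, h1', h2, h2']
  rw [Finset.sum_congr rfl fun t _ => hsplit t, Finset.sum_add_distrib, Finset.sum_sub_distrib,
    Finset.sum_sub_distrib, Finset.sum_ite_eq' Finset.univ (c, d), if_pos (Finset.mem_univ _)]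
  congr 2
  · congr 1
    rw [Fintype.sum_prod_type, Finset.sum_eq_single c]
    · simp
    · intro a _ ha
      exact Finset.sum_eq_zero fun b _ => by rw [if_neg ha]
    · intro h; exact absurd (Finset.mem_univ _) h
  · rw [Fintype.sum_prod_type_right, Finset.sum_eq_single d]
    · simp
    · intro b _ hb
      exact Finset.sum_eq_zero fun a _ => by rw [if_neg hb]
    · intro h; exact absurd (Finset.mem_univ _) h

/-- ★ **The pattern `(J − 1) ⊗ (J − 1)` is injective** for `n ≠ 1` (characteristic `0`). [folklore] -/
theorem offDiag2_mulVec_injective (hn : n ≠ 1) :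
    Function.Injective
      (Matrix.of fun s t : Fin n × Fin n => if s.2 ≠ t.2 ∧ s.1 ≠ t.1 then (1 : ℂ) else 0).mulVec := by
  classical
  set M : Matrix (Fin n × Fin n) (Fin n × Fin n) ℂ :=
    Matrix.of fun s t : Fin n × Fin n => if s.2 ≠ t.2 ∧ s.1 ≠ t.1 then (1 : ℂ) else 0 with hM
  suffices hker : ∀ y, M.mulVec y = 0 → y = 0 by
    intro y y' h
    have h0 := hker (y - y') (by rw [Matrix.mulVec_sub, h, sub_self])
    exact sub_eq_zero.mp h0
  intro y hy
  set T : ℂ := ∑ t, y t with hT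
  set R : Fin n → ℂ := fun c => ∑ b, y (c, b) with hR
  set Cc : Fin n → ℂ := fun d => ∑ a, y (a, d) with hCc
  have key : ∀ c d, T - R c - Cc d + y (c, d) = 0 := by
    intro c d
    have h := congrFun hy (c, d)
    rw [Pi.zero_apply, hM, offDiag2_mulVec_apply] at h
    exact h
  have hn1 : (n : ℂ) - 1 ≠ 0 := by
    rw [sub_ne_zero]
    exact_mod_cast hn
  have hRT : ∀ c, ∑ d, y (c, d) = R c := fun c => rfl
  have hCT : ∑ d, Cc d = T := by rw [hT, Fintype.sum_prod_type_right]
  have hRsum : ∑ c, R c = T := by rw [hT, Fintype.sum_prod_type]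
  have hCR : ∀ d, ∑ c, y (c, d) = Cc d := fun d => rfl
  -- rows: `R c = T`
  have hRc : ∀ c, R c = T := by
    intro c
    have h : ∑ d, (T - R c - Cc d + y (c, d)) = 0 := Finset.sum_eq_zero fun d _ => key c d
    rw [Finset.sum_add_distrib, Finset.sum_sub_distrib, Finset.sum_sub_distrib, Finset.sum_const,
      Finset.sum_const, Finset.card_univ, Fintype.card_fin, hCT, hRT, nsmul_eq_mul, nsmul_eq_mul] at h
    have h' : ((n : ℂ) - 1) * (T - R c) = 0 := by linear_combination h
    have h'' := (mul_eq_zero.mp h').resolve_left hn1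
    linear_combination -h''
  -- columns: `Cc d = T`
  have hCd : ∀ d, Cc d = T := by
    intro d
    have h : ∑ c, (T - R c - Cc d + y (c, d)) = 0 := Finset.sum_eq_zero fun c _ => key c d
    rw [Finset.sum_add_distrib, Finset.sum_sub_distrib, Finset.sum_sub_distrib, Finset.sum_const,
      Finset.sum_const, Finset.card_univ, Fintype.card_fin, hRsum, hCR, nsmul_eq_mul, nsmul_eq_mul] at h
    have h' : ((n : ℂ) - 1) * (T - Cc d) = 0 := by linear_combination h
    have h'' := (mul_eq_zero.mp h').resolve_left hn1
    linear_combination -h''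
  -- total: `T = 0`
  have hT0 : T = 0 := by
    have h : ∑ c, R c = (n : ℂ) * T := by
      rw [Finset.sum_congr rfl fun c _ => hRc c, Finset.sum_const, Finset.card_univ, Fintype.card_fin,
        nsmul_eq_mul]
    rw [hRsum] at h
    have h' : ((n : ℂ) - 1) * T = 0 := by linear_combination -h
    exact (mul_eq_zero.mp h').resolve_left hn1
  funext ⟨c, d⟩
  have h := key c d
  rw [hRc, hCd, hT0] at h
  rw [Pi.zero_apply]
  linear_combination h

/-- ★ **Factorisation of the Hessian at a rank-one point**: `Hess per_n (u vᵀ) = ((n−2)!·∏u·∏v) · D M D` with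
`D = diag((u_a v_b)⁻¹)` and `M = (J − 1) ⊗ (J − 1)`, for `u_i, v_j ≠ 0`. [folklore] -/
theorem hess0_transl_rankOne_perPoly_eq_smul (u v : Fin n → ℂ) (hu : ∀ i, u i ≠ 0) (hv : ∀ j, v j ≠ 0) :
    hess0 (transl (fun p : Fin n × Fin n => u p.1 * v p.2) (perPoly (Fin n) ℂ)) =
      (((n - 2).factorial : ℂ) * ((∏ r, u r) * ∏ i, v i)) •
        (Matrix.diagonal (fun t : Fin n × Fin n => (u t.1 * v t.2)⁻¹) *
          (Matrix.of fun s t : Fin n × Fin n => if s.2 ≠ t.2 ∧ s.1 ≠ t.1 then (1 : ℂ) else 0) *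
          Matrix.diagonal (fun t : Fin n × Fin n => (u t.1 * v t.2)⁻¹)) := by
  classical
  ext ⟨c, d⟩ ⟨a, b⟩
  rw [hess0_transl_rankOne_perPoly_apply, Matrix.smul_apply, Matrix.mul_diagonal, Matrix.diagonal_mul]
  simp only [Matrix.of_apply, smul_eq_mul]
  by_cases h : d ≠ b ∧ c ≠ a
  · rw [if_pos h, if_pos h, mul_one]
    -- `∏_{r ∉ {a,c}} u_r = ∏u / (u_a u_c)`, `∏_{i ∉ {b,d}} v_i = ∏v / (v_b v_d)`
    have hua : (∏ r ∈ (Finset.univ.erase a).erase c, u r) * u c * u a = ∏ r, u r := by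
      rw [Finset.prod_erase_mul _ _ (Finset.mem_erase.mpr ⟨h.2, Finset.mem_univ c⟩),
        Finset.prod_erase_mul _ _ (Finset.mem_univ a)]
    have hvb : (∏ i ∈ (Finset.univ.erase b).erase d, v i) * v d * v b = ∏ i, v i := by
      rw [Finset.prod_erase_mul _ _ (Finset.mem_erase.mpr ⟨h.1, Finset.mem_univ d⟩),
        Finset.prod_erase_mul _ _ (Finset.mem_univ b)]
    have hu2 : u c * u a ≠ 0 := mul_ne_zero (hu c) (hu a)
    have hv2 : v d * v b ≠ 0 := mul_ne_zero (hv d) (hv b)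
    have hua' : (∏ r ∈ (Finset.univ.erase a).erase c, u r) = (∏ r, u r) / (u c * u a) := by
      rw [eq_div_iff hu2, ← hua, mul_assoc]
    have hvb' : (∏ i ∈ (Finset.univ.erase b).erase d, v i) = (∏ i, v i) / (v d * v b) := by
      rw [eq_div_iff hv2, ← hvb, mul_assoc]
    rw [hua', hvb']
    field_simp
  · rw [if_neg h, if_neg h, mul_zero, zero_mul, mul_zero]

/-- ★★ **Every rank-one point with non-zero entries is a full-rank point of the Hessian of the permanent**: for `n ≥ 2` and
`u_i, v_j ≠ 0`, `rank Hess per_n (u vᵀ) = n²`.  (With ✓ `rank_hess0_transl_permPoint_perPoly`: every hyperplane of `M_n(ℂ)` contains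
such a point or a permutation point — PG(1) of memo NINETEENTH-HAND.md, on paper.) [cite: MignonRessayre2004, §3 — via the tree;
folklore] -/
theorem rank_hess0_transl_rankOne_perPoly (hn : 2 ≤ n) (u v : Fin n → ℂ) (hu : ∀ i, u i ≠ 0) (hv : ∀ j, v j ≠ 0) :
    (hess0 (transl (fun p : Fin n × Fin n => u p.1 * v p.2) (perPoly (Fin n) ℂ))).rank = n ^ 2 := by
  classical
  rw [hess0_transl_rankOne_perPoly_eq_smul u v hu hv]
  have hK : ((n - 2).factorial : ℂ) * ((∏ r, u r) * ∏ i, v i) ≠ 0 :=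
    mul_ne_zero (by exact_mod_cast (Nat.factorial_pos _).ne')
      (mul_ne_zero (Finset.prod_ne_zero_iff.mpr fun r _ => hu r) (Finset.prod_ne_zero_iff.mpr fun i _ => hv i))
  rw [rank_smul_eq hK]
  have hD : IsUnit (Matrix.diagonal (fun t : Fin n × Fin n => (u t.1 * v t.2)⁻¹)).det := by
    rw [Matrix.det_diagonal]
    exact isUnit_iff_ne_zero.mpr (Finset.prod_ne_zero_iff.mpr fun t _ => inv_ne_zero (mul_ne_zero (hu t.1) (hv t.2)))
  rw [Matrix.rank_mul_eq_left_of_isUnit_det _ _ hD, Matrix.rank_mul_eq_right_of_isUnit_det _ _ hD,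
    Matrix.rank_of_isUnit _ (Matrix.mulVec_injective_iff_isUnit.mp (offDiag2_mulVec_injective (by omega))),
    Fintype.card_prod, Fintype.card_fin, sq]

end RankOnePoint

end Summit.ValiantsHypothesis.ValiantsHypothesis.Theorems.GrenetZeonTwoDimCoefficients.ScalingClosure

end
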